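import Summits.BirchSwinnertonDyer.BirchSwinnertonDyer.Theorems.RamifiedSevenEllipticUnitsStrictControlStrictTower
import Summits.BirchSwinnertonDyer.BirchSwinnertonDyer.Theorems.RamifiedSevenEllipticUnitsStrictControlStrictLocalIso
import Literature.NumberTheory.EllipticCurves.SelmerPInftyGaloisAction
import Literature.NumberTheory.EllipticCurves.BSDSelmerParityDokchitserBaseChangeProofs
import HarnessLib

set_option linter.dupNamespace false
set_option autoImplicit false

/-!
# Route `RamifiedSevenEllipticUnits` (rung K7r), crux `StrictControlSeven` (stmt-BirchSwinnertonDyer-19145):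
# the STRICT local condition is transported by `Aut(K/ℚ)` (brick (s3) of the twist-descent step)

Cell `bsd-cm`, seat `bsd-cm-k7r-c4` (g0). HONEST FRAMING: nothing here closes the crux; BSD is not
proved by any of this. This file is the `p^∞`-**torsion**-coefficient companion of the tree's
`conjH1Points_mem_localRestrictionKer_iff` / `conjH1Primary_mem_selmerLocalKerPrimary_iff`
(`Literature/NumberTheory/EllipticCurves/SelmerPInftyGaloisAction.lean`): for `E = W/ℚ`, a field
`K ⊇ ℚ`, `σ ∈ Aut(K/ℚ)` with lift `τ` to `K̄`, and a `σ`-semilinear ring isomorphism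
`θ : E ≃+* E'` of `K`-fields, the class `τ_* s ∈ H¹(K, E[p^∞])` dies in `H¹(E', E(K̄_{E'})[p^∞])`
iff `s` dies in `H¹(E, E(K̄_E)[p^∞])`. Consequently the subgroup of `H¹(K, E[p^∞])` of classes
satisfying the **strict** (torsion-kernel) condition at every finite place of a number field `K` is
stable under `Aut(K/ℚ)` — the `c_* T ⊆ T` input of the `±`-decomposition
(`IndexTwoDecompositionData.conj_mem`) for the strict Selmer groups, Dokchitser–Dokchitser 2010,
Lemma 4.14 (proof), strict variant.

## What is proved

* `localPointsMap_mem_primaryComponent`, `primaryLocalPointsMap_smul` — the local points map of a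
  lift `Θ : K̄_E ≃+* K̄_{E'}` preserves `p`-primary parts, compatibly with `Θ⁻¹ (·) Θ` on Galois
  groups.
* `primaryLocalPointsMap_h1_injective` — the induced map
  `H¹(E, E(K̄_E)[p^∞]) → H¹(E', E(K̄_{E'})[p^∞])` is injective (`Θ⁻¹` induces a left inverse).
* `conjH1Primary_mem_selmerLocalKerPrimaryTorsion_iff` — **transport of the strict condition**.
* `conjH1Primary_mem_iInf_selmerLocalKerPrimaryTorsion` — **`Aut(K/ℚ)`-stability of the
  everywhere-strict finite conditions** over a number field `K` (Galois transport of completions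
  `galAdicCompletionEquiv`).
* `mem_selmerLocalKerPrimaryTorsion_iff_hPsiK_mem`, `mem_iInf_selmerLocalKerPrimaryTorsion_iff_hPsiK_mem`
  — the strict conditions under the `K`-level twist isomorphism `hPsiK` of
  `BSDSelmerParityDokchitserBaseChangeProofs` (`K = ℚ(θ)`, `θ² = c`).

References: [CasselsFrohlichANT1967] Ch. VII §1.1; [SerreGaloisCohomology1997] I.§2.4, II.§1.1;
[DokchitserDokchitserAnnals2010] Lemma 4.14 (proof); [GrossLMS1991] §5 (5.1).
-/

noncomputable section

open scoped Classical

open WeierstrassCurve CategoryTheory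
  Literature.NumberTheory.EllipticCurves
  Literature.NumberTheory.GaloisRepresentations

universe u

namespace Summit.BirchSwinnertonDyer.BirchSwinnertonDyer.Theorems.RamifiedSevenEllipticUnits

/-! ## §1 The `p`-primary local points map of a lift `Θ` and the injectivity of its `H¹`-map -/

section Transport

variable {K : Type u} [Field K] [CharZero K] (W : WeierstrassCurve ℚ) (p : ℕ)
variable {E E' : Type u} [Field E] [Algebra K E] [Field E'] [Algebra K E'] [CharZero E] [CharZero E']
variable {θ : E ≃+* E'} {Θ : AlgebraicClosure E ≃+* AlgebraicClosure E'}

/-- The local points map `E(K̄_E) → E(K̄_{E'})` of a ring isomorphism `Θ : K̄_E ≃+* K̄_{E'}` maps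
`p`-primary points to `p`-primary points. [folklore] -/
theorem localPointsMap_mem_primaryComponent (Θ : AlgebraicClosure E ≃+* AlgebraicClosure E')
    (Q : AddCommGroup.primaryComponent (localPoints (W.baseChange K) E) p) :
    localPointsMap W Θ (Q : localPoints (W.baseChange K) E) ∈
      AddCommGroup.primaryComponent (localPoints (W.baseChange K) E') p :=
  map_mem_primaryComponent (localPointsMap W Θ) Q.2

/-- Compatibility of the pair `(Θ⁻¹ (·) Θ, Θ_*)` on `p`-primary local points:
`Θ (Θ⁻¹ g Θ • Q) = g • Θ Q` (`IsLiftOfRingEquiv.localPointsMap_smul`). [folklore] -/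
theorem primaryLocalPointsMap_smul (hΘ : IsLiftOfRingEquiv θ Θ) (g : Field.absoluteGaloisGroup E')
    (Q : AddCommGroup.primaryComponent (localPoints (W.baseChange K) E) p) :
    (((localPointsMap W Θ).comp
        (AddCommGroup.primaryComponent (localPoints (W.baseChange K) E) p).subtype).codRestrict
        (AddCommGroup.primaryComponent (localPoints (W.baseChange K) E') p)
        (localPointsMap_mem_primaryComponent W p Θ)) (hΘ.conjGalCMH g • Q) =
      g • (((localPointsMap W Θ).comp
        (AddCommGroup.primaryComponent (localPoints (W.baseChange K) E) p).subtype).codRestrict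
        (AddCommGroup.primaryComponent (localPoints (W.baseChange K) E') p)
        (localPointsMap_mem_primaryComponent W p Θ)) Q := by
  apply Subtype.ext
  simp only [AddMonoidHom.codRestrict_apply, AddMonoidHom.coe_comp, AddSubgroup.coe_subtype,
    Function.comp_apply, primaryComponent.coe_smul]
  exact hΘ.localPointsMap_smul W g (Q : localPoints (W.baseChange K) E)

/-- **The map `H¹(E, E(K̄_E)[p^∞]) → H¹(E', E(K̄_{E'})[p^∞])` induced by a lift `Θ` of
`θ : E ≃+* E'` is injective**: the map induced by `Θ⁻¹` is a left inverse
(`ContinuousCohomology.map_comp`, `map_id`; the tree's `IsLiftOfRingEquiv.map_injective` with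
`E(K̄_E)[p^∞]` in place of `E(K̄_E)`). Serre, *Galois Cohomology*, I.§2.4. [folklore] -/
theorem primaryLocalPointsMap_h1_injective (hΘ : IsLiftOfRingEquiv θ Θ) :
    Function.Injective (ContinuousCohomology.map hΘ.conjGalCMH
      (resHomOfEquivariant hΘ.conjGalCMH
        (((localPointsMap W Θ).comp
          (AddCommGroup.primaryComponent (localPoints (W.baseChange K) E) p).subtype).codRestrict
          (AddCommGroup.primaryComponent (localPoints (W.baseChange K) E') p)
          (localPointsMap_mem_primaryComponent W p Θ))
        (primaryLocalPointsMap_smul W p hΘ)) 1) := by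
  have hΘ' : IsLiftOfRingEquiv θ.symm Θ.symm := hΘ.symm
  have hΨ : (((localPointsMap W Θ.symm).comp
      (AddCommGroup.primaryComponent (localPoints (W.baseChange K) E') p).subtype).codRestrict
      (AddCommGroup.primaryComponent (localPoints (W.baseChange K) E) p)
      (localPointsMap_mem_primaryComponent W p Θ.symm)).comp
      (((localPointsMap W Θ).comp
        (AddCommGroup.primaryComponent (localPoints (W.baseChange K) E) p).subtype).codRestrict
        (AddCommGroup.primaryComponent (localPoints (W.baseChange K) E') p)
        (localPointsMap_mem_primaryComponent W p Θ)) = AddMonoidHom.id _ := by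
    apply AddMonoidHom.ext
    intro Q
    apply Subtype.ext
    simp only [AddMonoidHom.coe_comp, Function.comp_apply, AddMonoidHom.codRestrict_apply,
      AddSubgroup.coe_subtype, AddMonoidHom.id_apply]
    exact localPointsMap_symm_apply W Θ (Q : localPoints (W.baseChange K) E)
  have hcomp := map_one_eq_comp_of_eq hΘ.conjGalCMH
    (((localPointsMap W Θ).comp
      (AddCommGroup.primaryComponent (localPoints (W.baseChange K) E) p).subtype).codRestrict
      (AddCommGroup.primaryComponent (localPoints (W.baseChange K) E') p)
      (localPointsMap_mem_primaryComponent W p Θ))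
    (primaryLocalPointsMap_smul W p hΘ) hΘ'.conjGalCMH
    (((localPointsMap W Θ.symm).comp
      (AddCommGroup.primaryComponent (localPoints (W.baseChange K) E') p).subtype).codRestrict
      (AddCommGroup.primaryComponent (localPoints (W.baseChange K) E) p)
      (localPointsMap_mem_primaryComponent W p Θ.symm))
    (primaryLocalPointsMap_smul W p hΘ')
    (Φ := ContinuousMonoidHom.id _) (Ψ := AddMonoidHom.id _) (fun _ _ ↦ rfl)
    hΘ.conjGalCMH_comp_symm.symm hΨ.symm
  rw [map_one_eq_id_of_eq (fun _ _ ↦ rfl) rfl rfl] at hcomp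
  intro a b hab
  have ha := congr($hcomp a)
  have hb := congr($hcomp b)
  simp only [ConcreteCategory.id_apply, ConcreteCategory.comp_apply] at ha hb
  rw [ha, hab, ← hb]

/-! ## §2 Transport of the strict condition along a `σ`-semilinear isomorphism -/

variable {σ : K ≃ₐ[ℚ] K} {τ : AlgebraicClosure K ≃+* AlgebraicClosure K}

/-- **Transport of the strict local condition.** For `E = W/ℚ`, `σ ∈ Aut(K/ℚ)` with lift `τ`,
and a `σ`-semilinear ring isomorphism `θ : E ≃+* E'` of `K`-fields, a class
`s ∈ H¹(K, E[p^∞])` dies in `H¹(E, E(K̄_E)[p^∞])` iff `τ_* s` dies in `H¹(E', E(K̄_{E'})[p^∞])`: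
with the embedding `ι' = Θ ι_E τ⁻¹` at `E'` (allowed by
`selmerLocalKerPrimaryTorsion_eq_resKer_ofEmb`) the pair computing `(τ_* s)|_{E'}` is the pair
computing `s|_E` followed by the isomorphism of pairs induced by a lift `Θ` of `θ`, whose `H¹`-map
is injective (`primaryLocalPointsMap_h1_injective`). Verbatim the argument of the tree's
`conjH1Points_mem_localRestrictionKer_iff`, with `E(K̄_·)[p^∞]` as coefficients.
[cite: CasselsFrohlichANT1967, Ch. VII §1.1] -/
theorem conjH1Primary_mem_selmerLocalKerPrimaryTorsion_iff (hτ : IsLiftOfAut σ τ) (θ : E ≃+* E')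
    (hθ : IsSemilinearRingEquiv σ θ) (s : galH1Primary (W.baseChange K) p) :
    hτ.conjH1Primary W p s ∈ selmerLocalKerPrimaryTorsion (W.baseChange K) E' p ↔
      s ∈ selmerLocalKerPrimaryTorsion (W.baseChange K) E p := by
  have hΘ : IsLiftOfRingEquiv θ (ringEquivLift θ) := isLiftOfRingEquiv_ringEquivLift θ
  set ι' := embOfLifts hτ hθ hΘ
  rw [selmerLocalKerPrimaryTorsion_eq_resKer_ofEmb (W.baseChange K) p ι']
  -- the two composite pairs and their `H¹` maps
  have hA := map_one_eq_comp_of_eq hτ.conjGalCMH (hτ.primaryTorsionMap W p)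
    (hτ.primaryTorsionMap_smul W p) (resGalOfEmb ι')
    (((pointsMapOfEmb (W.baseChange K) ι').comp
      ((W.baseChange K).geomPrimaryTorsion p).subtype).codRestrict
      (AddCommGroup.primaryComponent (localPoints (W.baseChange K) E') p)
      (pointsMapOfEmb_mem_primaryComponent (W.baseChange K) p ι'))
    (primaryPointsMapOfEmb_smul (W.baseChange K) p ι')
    (Φ := hτ.conjGalCMH.comp (resGalOfEmb ι'))
    (Ψ := (((pointsMapOfEmb (W.baseChange K) ι').comp
      ((W.baseChange K).geomPrimaryTorsion p).subtype).codRestrict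
      (AddCommGroup.primaryComponent (localPoints (W.baseChange K) E') p)
      (pointsMapOfEmb_mem_primaryComponent (W.baseChange K) p ι')).comp (hτ.primaryTorsionMap W p))
    (fun g P ↦ by
      simp only [AddMonoidHom.coe_comp, Function.comp_apply, ContinuousMonoidHom.comp_toFun]
      rw [hτ.primaryTorsionMap_smul W p]
      exact primaryPointsMapOfEmb_smul _ p ι' g _) rfl rfl
  have hB := map_one_eq_comp_of_eq (resGal (K := K) E) (primaryPointsMap (W.baseChange K) E p)
    (primaryPointsMap_smul _ E p) hΘ.conjGalCMH
    (((localPointsMap W (ringEquivLift θ)).comp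
      (AddCommGroup.primaryComponent (localPoints (W.baseChange K) E) p).subtype).codRestrict
      (AddCommGroup.primaryComponent (localPoints (W.baseChange K) E') p)
      (localPointsMap_mem_primaryComponent W p (ringEquivLift θ)))
    (primaryLocalPointsMap_smul W p hΘ)
    (Φ := (resGal (K := K) E).comp hΘ.conjGalCMH)
    (Ψ := (((localPointsMap W (ringEquivLift θ)).comp
      (AddCommGroup.primaryComponent (localPoints (W.baseChange K) E) p).subtype).codRestrict
      (AddCommGroup.primaryComponent (localPoints (W.baseChange K) E') p)
      (localPointsMap_mem_primaryComponent W p (ringEquivLift θ))).comp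
        (primaryPointsMap (W.baseChange K) E p))
    (fun g P ↦ by
      simp only [AddMonoidHom.coe_comp, Function.comp_apply, ContinuousMonoidHom.comp_toFun]
      rw [← primaryLocalPointsMap_smul W p hΘ]
      congr 1
      exact primaryPointsMap_smul _ E p _ _) rfl rfl
  have hAB := map_one_pair_congr (conjGalCMH_comp_resGalOfEmb_embOfLifts hτ hθ hΘ)
    (show (((pointsMapOfEmb (W.baseChange K) ι').comp
        ((W.baseChange K).geomPrimaryTorsion p).subtype).codRestrict
        (AddCommGroup.primaryComponent (localPoints (W.baseChange K) E') p)
        (pointsMapOfEmb_mem_primaryComponent (W.baseChange K) p ι')).comp (hτ.primaryTorsionMap W p) =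
      (((localPointsMap W (ringEquivLift θ)).comp
        (AddCommGroup.primaryComponent (localPoints (W.baseChange K) E) p).subtype).codRestrict
        (AddCommGroup.primaryComponent (localPoints (W.baseChange K) E') p)
        (localPointsMap_mem_primaryComponent W p (ringEquivLift θ))).comp
          (primaryPointsMap (W.baseChange K) E p) from
      AddMonoidHom.ext fun P ↦ Subtype.ext
        (DFunLike.congr_fun (pointsMapOfEmb_embOfLifts_comp_pointsMap W hτ hθ hΘ)
          (P : geomPoints (W.baseChange K))))
    (fun g P ↦ by
      simp only [AddMonoidHom.coe_comp, Function.comp_apply, ContinuousMonoidHom.comp_toFun]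
      rw [hτ.primaryTorsionMap_smul W p]
      exact primaryPointsMapOfEmb_smul _ p ι' g _)
    (fun g P ↦ by
      simp only [AddMonoidHom.coe_comp, Function.comp_apply, ContinuousMonoidHom.comp_toFun]
      rw [← primaryLocalPointsMap_smul W p hΘ]
      congr 1
      exact primaryPointsMap_smul _ E p _ _)
  rw [hA, hB] at hAB
  -- conclude
  rw [mem_resKer_iff, selmerLocalKerPrimaryTorsion, mem_resKer_iff, IsLiftOfAut.conjH1Primary,
    resH1Hom]
  simp only [LinearMap.toAddMonoidHom_coe, ContinuousLinearMap.coe_coe]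
  rw [← ConcreteCategory.comp_apply, hAB, ConcreteCategory.comp_apply]
  constructor
  · intro h
    apply primaryLocalPointsMap_h1_injective W p hΘ
    rw [h, map_zero]
  · intro h
    rw [h, map_zero]

end Transport

/-! ## §3 Stability of the everywhere-strict finite conditions over a number field -/

section NumberField

open NumberField IsDedekindDomain Literature.NumberTheory.Automorphic

variable {K : Type u} [Field K] [NumberField K] (W : WeierstrassCurve ℚ) (p : ℕ)
  {σ : K ≃ₐ[ℚ] K} {τ : AlgebraicClosure K ≃+* AlgebraicClosure K}

/-- **The everywhere-strict finite conditions of `E = W/ℚ` over a number field `K` are stable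
under `Aut(K/ℚ)`**: if `s ∈ H¹(K, E[p^∞])` dies in `H¹(K_v, E(K̄_v)[p^∞])` for every finite place
`v`, so does `τ_* s` — `τ_*` carries the strict condition at `σ⁻¹ v` to the strict condition at
`v` (`conjH1Primary_mem_selmerLocalKerPrimaryTorsion_iff` with the `σ`-semilinear Galois
transport of completions `galAdicCompletionEquiv σ : K_{σ⁻¹ v} ≃+* K_v`). The strict analogue of
the tree's `conjH1Primary_mem_finSelmerGroupPInfty`; it is the `c_* T ⊆ T` input of the
`±`-decomposition for strict Selmer groups (Dokchitser–Dokchitser 2010, Lemma 4.14, proof).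
[cite: DokchitserDokchitserAnnals2010, Lemma 4.14 (proof)] -/
theorem conjH1Primary_mem_iInf_selmerLocalKerPrimaryTorsion (hτ : IsLiftOfAut σ τ)
    {s : galH1Primary (W.baseChange K) p}
    (hs : s ∈ ⨅ v : HeightOneSpectrum (𝓞 K),
      selmerLocalKerPrimaryTorsion (W.baseChange K) (v.adicCompletion K) p) :
    hτ.conjH1Primary W p s ∈ ⨅ v : HeightOneSpectrum (𝓞 K),
      selmerLocalKerPrimaryTorsion (W.baseChange K) (v.adicCompletion K) p := by
  rw [AddSubgroup.mem_iInf] at hs ⊢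
  intro v'
  have h : σ • (σ⁻¹ • v') = v' := smul_inv_smul σ v'
  haveI : CharZero ((σ⁻¹ • v').adicCompletion K) :=
    charZero_of_injective_algebraMap (algebraMap K _).injective
  haveI : CharZero (v'.adicCompletion K) :=
    charZero_of_injective_algebraMap (algebraMap K _).injective
  exact (conjH1Primary_mem_selmerLocalKerPrimaryTorsion_iff W p hτ
    (galAdicCompletionEquiv (L := K) σ h) (isSemilinearRingEquiv_galAdicCompletionEquiv σ h) s).mpr
    (hs _)

end NumberField

/-! ## §4 The strict conditions under the `K`-level twist isomorphism `hPsiK` -/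

section Twist

open NumberField IsDedekindDomain

variable (W : WeierstrassCurve ℚ) (K : Type) [Field K] [NumberField K]
  {θ : K} {c : ℚ} (hθ : θ ∉ Set.range (algebraMap ℚ K)) (hc : θ ^ 2 = algebraMap ℚ K c) (p : ℕ)

/-- **`hPsiK` respects the strict local condition at every `K`-field**: for `K = ℚ(θ)`, `θ² = c`,
the `K`-level twist isomorphism `hPsiK : H¹(K, E^{(c)}_K[p^∞]) ≃+ H¹(K, E_K[p^∞])` (composite of
two `h1PrimaryIso` along changes of variables over `K`) carries the classes dying in
`H¹(E, E^{(c)}(K̄_E)[p^∞])` onto the classes dying in `H¹(E, E(K̄_E)[p^∞])`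
(`mem_selmerLocalKerPrimaryTorsion_iff_h1PrimaryIso_mem` twice). The strict companion of the
tree's `mem_selmerLocalKerPrimary_iff_hPsiK_mem`. [folklore] -/
theorem mem_selmerLocalKerPrimaryTorsion_iff_hPsiK_mem (E : Type) [Field E] [Algebra K E]
    (s : galH1Primary ((W.quadraticTwist c).baseChange K) p) :
    s ∈ selmerLocalKerPrimaryTorsion ((W.quadraticTwist c).baseChange K) E p ↔
      hPsiK W K hθ hc p s ∈ selmerLocalKerPrimaryTorsion (W.baseChange K) E p := by
  rw [hPsiK, AddEquiv.trans_apply,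
    mem_selmerLocalKerPrimaryTorsion_iff_h1PrimaryIso_mem E p (twistUntwist_smul_baseChange W hθ hc) s,
    mem_selmerLocalKerPrimaryTorsion_iff_h1PrimaryIso_mem E p
      (map_smul_baseChange_eq_quadraticTwist_one W (sqChange_spec W) (K := K)),
    AddEquiv.apply_symm_apply]

/-- **`hPsiK` respects the everywhere-strict finite conditions** (the previous lemma at every
completion `K_v`). [folklore] -/
theorem mem_iInf_selmerLocalKerPrimaryTorsion_iff_hPsiK_mem
    (s : galH1Primary ((W.quadraticTwist c).baseChange K) p) :
    (s ∈ ⨅ v : HeightOneSpectrum (𝓞 K),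
        selmerLocalKerPrimaryTorsion ((W.quadraticTwist c).baseChange K) (v.adicCompletion K) p) ↔
      hPsiK W K hθ hc p s ∈ ⨅ v : HeightOneSpectrum (𝓞 K),
        selmerLocalKerPrimaryTorsion (W.baseChange K) (v.adicCompletion K) p := by
  simp only [AddSubgroup.mem_iInf]
  exact forall_congr' fun v ↦ mem_selmerLocalKerPrimaryTorsion_iff_hPsiK_mem W K hθ hc p _ s

end Twist

end Summit.BirchSwinnertonDyer.BirchSwinnertonDyer.Theorems.RamifiedSevenEllipticUnits

end
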